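import Literature.Topology.FourManifolds.BoundaryConnectedSum
import Literature.Topology.FourManifolds.ConnectedSumData
import Literature.Topology.FourManifolds.GluingConstruction
import Literature.Topology.FourManifolds.GluingCharts
import Literature.Topology.FourManifolds.GluingUniqueness
import HarnessLib

/-!
# Existence of boundary connected sums (proof of `Literature.Topology.FourManifolds.exists_isOpenGluing_boundaryConnectedSumRel`)

This file discharges the named fact `Literature.Topology.FourManifolds.exists_isOpenGluing_boundaryConnectedSumRel` of
`Literature.Topology.FourManifolds.BoundaryConnectedSum`: for half-discs `h₁ : ℝⁿ₊ ↪ X`,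
`h₂ : ℝⁿ₊ ↪ Y` (smooth embeddings of the closed half space with open ranges) in smooth
`n`-manifolds with boundary `X`, `Y` (Hausdorff, second countable), there is a smooth `n`-manifold
with boundary `P` (Hausdorff, second countable) which is the open gluing of the punctured pieces
`X ∖ {h₁ 0}`, `Y ∖ {h₂ 0}` along Juhász's relation `h₁ (t • v) ∼ h₂ ((1 - t) • v)` — the boundary
connected sum `X ♮ Y` of Juhász, *Differential and Low-Dimensional Topology* (2023), Def. 1.47.

The construction runs parallel to the tree's construction of connected sums
(`ConnectedSumData.lean`, `ConnectedSumExistence.lean`), with two differences.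
* The half-discs are *given* smooth embeddings rather than inverses of charts, so the smoothness
  of the gluing map `Φ = h₂ ∘ ψ ∘ h₁⁻¹` (`ψ` Kervaire–Milnor's inversion `t • v ↦ (1 - t) • v` of
  the punctured unit half-disc) is obtained by *descent along the open immersion `h₁`*
  (`Literature.Topology.FourManifolds.contMDiffAt_of_comp_isImmersionAt`, `GluingUniqueness.lean`).
* The pieces have boundary, so the smooth structure on the pushout
  `Literature.Topology.FourManifolds.SmoothGlueData.Glued` (`GluingConstruction.lean`, whose own atlas is for boundaryless
  models) is installed with the model-generic two-chart gluing of `GluingCharts.lean`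
  (`Literature.IsOpenCover₂.chartedSpace/isManifold/isSmoothEmbedding_left/right`, model change
  `f = id`).
Hausdorffness comes, as for connected sums, from the closedness of the graph of the relation
(the centres are removed; Kosinski, *Differential Manifolds* (1993), VI.1, proof of (1.1)), and
second countability from the cover by the two second countable pieces.

## Main results (all proved; the only definitions are the auxiliary gluing data)

* `Literature.Topology.FourManifolds.halfDiscInversion`: Kervaire–Milnor's inversion of the punctured open unit half-disc of
  `EuclideanHalfSpace n`, as an open partial homeomorphism, and its smoothness
  (`Literature.Topology.FourManifolds.contMDiffOn_halfDiscInversion`) for the model with boundary `𝓡∂ n`.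
* `Literature.Topology.FourManifolds.HalfDiscPair`: two half-discs `h₁`, `h₂` as in the fact; `HalfDiscPair.Φ`, `HalfDiscPair.φ`
  the gluing map between the punctured pieces; `HalfDiscPair.boundaryConnectedSumRel_iff_φ` (the
  relation is the graph of `φ`); `HalfDiscPair.isClosed_graph_φ`; `HalfDiscPair.contMDiffOn_φ`.
* `Literature.Topology.FourManifolds.HalfDiscPair.exists_isOpenGluing`: the glued space is a smooth manifold with boundary
  which is an open gluing along `boundaryConnectedSumRel h₁ h₂`.
* `Literature.Topology.FourManifolds.exists_isOpenGluing_boundaryConnectedSumRel_holds`: the discharge.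

## References

* A. Juhász, *Differential and Low-Dimensional Topology*, LMS Student Texts 104 (2023), Def. 1.47.
* M. Kervaire, J. Milnor, *Groups of homotopy spheres I*, Ann. of Math. 77 (1963), §2.
* A. Kosinski, *Differential Manifolds* (1993), VI.1.
* M. Hirsch, *Differential Topology*, GTM 33 (1976), Ch. 8 §2.
-/

open scoped Manifold ContDiff Topology
open Set Function Topology OpenPartialHomeomorph

noncomputable section

namespace Literature.Topology.FourManifolds

universe u

/-- Local notation: `𝔼 n` is the model Euclidean space `EuclideanSpace ℝ (Fin n)`. -/
local notation "𝔼 " n:arg => EuclideanSpace ℝ (Fin n)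

/-! ### §1 The inversion of the punctured unit half-disc -/

section Inversion

variable {n : ℕ} [NeZero n]

/-- The model with boundary `𝓡∂ n` is the inclusion of the closed half space (definitional).
[folklore] -/
theorem modelHalfSpace_apply (v : EuclideanHalfSpace n) : (𝓡∂ n) v = v.val := rfl

/-- The range of the model with boundary `𝓡∂ n` is the closed half space `{y | 0 ≤ y 0}`.
[folklore] -/
theorem range_modelHalfSpace : range (𝓡∂ n) = {y : 𝔼 n | 0 ≤ y 0} :=
  range_euclideanHalfSpace n

/-- Kervaire–Milnor's inversion `ψ v = ((1 - ‖v‖) ‖v‖⁻¹) • v` maps the punctured closed unit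
half-disc into the closed half space (it rescales by a nonnegative factor). [cite: KervaireMilnor1963, §2] -/
theorem discInversionFun_mem_range {v : EuclideanHalfSpace n} (hv1 : ‖v.val‖ ≤ 1) :
    discInversionFun v.val ∈ range (𝓡∂ n) := by
  rw [range_modelHalfSpace, mem_setOf_eq, discInversionFun]
  change 0 ≤ ((1 - ‖v.val‖) * ‖v.val‖⁻¹) * v.val 0
  exact mul_nonneg (mul_nonneg (sub_nonneg.2 hv1) (inv_nonneg.2 (norm_nonneg _))) v.2

/-- The underlying vector of `(𝓡∂ n).symm (ψ v)` is `ψ v` on the punctured closed unit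
half-disc. [cite: KervaireMilnor1963, §2] -/
theorem val_symm_discInversionFun {v : EuclideanHalfSpace n} (hv1 : ‖v.val‖ ≤ 1) :
    ((𝓡∂ n).symm (discInversionFun v.val)).val = discInversionFun v.val :=
  (𝓡∂ n).right_inv (discInversionFun_mem_range hv1)

/-- **The inversion of the punctured open unit half-disc** `{v ∈ ℝⁿ₊ | 0 < ‖v‖ < 1}`,
`t • v ↦ (1 - t) • v` (`‖v‖ = 1`), as an open partial homeomorphism of the closed half space
`EuclideanHalfSpace n` (an involution of its source); the total function is
`(𝓡∂ n).symm ∘ ψ ∘ (𝓡∂ n)` with `ψ = Literature.discInversionFun`. This is the identification made in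
a boundary connected sum (Juhász 2023, Def. 1.47; Kervaire–Milnor 1963, §2 for discs). [cite: Juhasz2023, Def. 1.47] -/
def halfDiscInversion : OpenPartialHomeomorph (EuclideanHalfSpace n) (EuclideanHalfSpace n) where
  toFun v := (𝓡∂ n).symm (discInversionFun v.val)
  invFun v := (𝓡∂ n).symm (discInversionFun v.val)
  source := {v | 0 < ‖v.val‖ ∧ ‖v.val‖ < 1}
  target := {v | 0 < ‖v.val‖ ∧ ‖v.val‖ < 1}
  map_source' v hv := by
    simp only [mem_setOf_eq] at hv ⊢
    rw [val_symm_discInversionFun hv.2.le, norm_discInversionFun (norm_pos_iff.1 hv.1) hv.2.le]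
    constructor <;> linarith [hv.1, hv.2]
  map_target' v hv := by
    simp only [mem_setOf_eq] at hv ⊢
    rw [val_symm_discInversionFun hv.2.le, norm_discInversionFun (norm_pos_iff.1 hv.1) hv.2.le]
    constructor <;> linarith [hv.1, hv.2]
  left_inv' v hv := by
    simp only [mem_setOf_eq] at hv
    apply EuclideanHalfSpace.ext
    have h1 : ‖((𝓡∂ n).symm (discInversionFun v.val)).val‖ ≤ 1 := by
      rw [val_symm_discInversionFun hv.2.le, norm_discInversionFun (norm_pos_iff.1 hv.1) hv.2.le]
      linarith [hv.1]
    rw [val_symm_discInversionFun h1, val_symm_discInversionFun hv.2.le,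
      discInversionFun_discInversionFun (norm_pos_iff.1 hv.1) hv.2]
  right_inv' v hv := by
    simp only [mem_setOf_eq] at hv
    apply EuclideanHalfSpace.ext
    have h1 : ‖((𝓡∂ n).symm (discInversionFun v.val)).val‖ ≤ 1 := by
      rw [val_symm_discInversionFun hv.2.le, norm_discInversionFun (norm_pos_iff.1 hv.1) hv.2.le]
      linarith [hv.1]
    rw [val_symm_discInversionFun h1, val_symm_discInversionFun hv.2.le,
      discInversionFun_discInversionFun (norm_pos_iff.1 hv.1) hv.2]
  open_source :=
    (isOpen_lt continuous_const (continuous_norm.comp continuous_subtype_val)).inter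
      (isOpen_lt (continuous_norm.comp continuous_subtype_val) continuous_const)
  open_target :=
    (isOpen_lt continuous_const (continuous_norm.comp continuous_subtype_val)).inter
      (isOpen_lt (continuous_norm.comp continuous_subtype_val) continuous_const)
  continuousOn_toFun :=
    (𝓡∂ n).continuous_symm.comp_continuousOn
      ((contDiffOn_discInversionFun.continuousOn).comp continuous_subtype_val.continuousOn
        fun v hv => (norm_pos_iff.1 hv.1 : v.val ≠ 0))
  continuousOn_invFun :=
    (𝓡∂ n).continuous_symm.comp_continuousOn
      ((contDiffOn_discInversionFun.continuousOn).comp continuous_subtype_val.continuousOn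
        fun v hv => (norm_pos_iff.1 hv.1 : v.val ≠ 0))

/-- Membership in the source of the half-disc inversion. [cite: Juhasz2023, Def. 1.47] -/
theorem mem_halfDiscInversion_source {v : EuclideanHalfSpace n} :
    v ∈ (halfDiscInversion (n := n)).source ↔ 0 < ‖v.val‖ ∧ ‖v.val‖ < 1 :=
  Iff.rfl

/-- The half-disc inversion as a function. [cite: Juhasz2023, Def. 1.47] -/
theorem halfDiscInversion_apply (v : EuclideanHalfSpace n) :
    halfDiscInversion v = (𝓡∂ n).symm (discInversionFun v.val) :=
  rfl

/-- On the punctured closed unit half-disc the underlying vector of `halfDiscInversion v` is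
`ψ v`. [cite: KervaireMilnor1963, §2] -/
theorem val_halfDiscInversion {v : EuclideanHalfSpace n} (hv1 : ‖v.val‖ ≤ 1) :
    (halfDiscInversion v).val = discInversionFun v.val :=
  val_symm_discInversionFun hv1

/-- `halfDiscInversion (t • v) = (1 - t) • v` for a unit vector `v` of the half space and
`0 < t ≤ 1`. [cite: Juhasz2023, Def. 1.47] -/
theorem halfDiscInversion_dilate {v : EuclideanHalfSpace n} (hv : ‖v.val‖ = 1) {t : ℝ}
    (ht0 : 0 < t) (ht1 : t ≤ 1) :
    halfDiscInversion (EuclideanHalfSpace.dilate t v) = EuclideanHalfSpace.dilate (1 - t) v := by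
  apply EuclideanHalfSpace.ext
  have hn : ‖(EuclideanHalfSpace.dilate t v).val‖ ≤ 1 := by
    rw [EuclideanHalfSpace.norm_val_dilate ht0.le hv]; exact ht1
  rw [val_halfDiscInversion hn, EuclideanHalfSpace.val_dilate_of_nonneg ht0.le,
    discInversionFun_smul hv ht0, EuclideanHalfSpace.val_dilate_of_nonneg (sub_nonneg.2 ht1)]

/-- **The half-disc inversion is smooth** for the model with boundary: it is
`(𝓡∂ n).symm ∘ ψ ∘ (𝓡∂ n)` with `ψ` smooth away from `0` and `(𝓡∂ n).symm` smooth on the range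
of the model. [folklore] -/
theorem contMDiffOn_halfDiscInversion :
    ContMDiffOn (𝓡∂ n) (𝓡∂ n) ∞ (halfDiscInversion (n := n)) halfDiscInversion.source := by
  have h1 : ContMDiffOn (𝓡∂ n) 𝓘(ℝ, 𝔼 n) ∞
      (fun v : EuclideanHalfSpace n => discInversionFun v.val) halfDiscInversion.source :=
    contDiffOn_discInversionFun.contMDiffOn.comp (𝓡∂ n).contMDiff.contMDiffOn
      fun v hv => (norm_pos_iff.1 hv.1 : v.val ≠ 0)
  exact (𝓡∂ n).contMDiffOn_symm.comp h1 fun v hv => discInversionFun_mem_range hv.2.le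

/-- The half-disc inversion is smooth at every point of its (open) source. [folklore] -/
theorem contMDiffAt_halfDiscInversion {v : EuclideanHalfSpace n}
    (hv : v ∈ (halfDiscInversion (n := n)).source) :
    ContMDiffAt (𝓡∂ n) (𝓡∂ n) ∞ (halfDiscInversion (n := n)) v :=
  (contMDiffOn_halfDiscInversion v hv).contMDiffAt (halfDiscInversion.open_source.mem_nhds hv)

end Inversion

/-! ### §2 Two half-discs and the gluing map between the punctured pieces -/

section Data

variable {n : ℕ} [NeZero n] {X Y : Type u} [TopologicalSpace X]
  [ChartedSpace (EuclideanHalfSpace n) X] [TopologicalSpace Y] [ChartedSpace (EuclideanHalfSpace n) Y]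

variable (n X Y) in
/-- **A pair of half-discs** as in `Literature.Topology.FourManifolds.exists_isOpenGluing_boundaryConnectedSumRel`: smooth
embeddings `h₁ : EuclideanHalfSpace n → X`, `h₂ : EuclideanHalfSpace n → Y` of the closed half
space with open ranges (half-discs `(H, D) ↪ (X, ∂X)`, `(H, D) ↪ (Y, ∂Y)`; Juhász 2023,
Def. 1.47). Auxiliary datum for the construction of `X ♮ Y`. [cite: Juhasz2023, Def. 1.47] -/
structure HalfDiscPair where
  /-- The half-disc in `X`. -/
  h₁ : EuclideanHalfSpace n → X
  /-- The half-disc in `Y`. -/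
  h₂ : EuclideanHalfSpace n → Y
  /-- `h₁` is a smooth embedding. -/
  isSmoothEmbedding₁ : Manifold.IsSmoothEmbedding (𝓡∂ n) (𝓡∂ n) ∞ h₁
  /-- `h₁` has open range. -/
  isOpen_range₁ : IsOpen (range h₁)
  /-- `h₂` is a smooth embedding. -/
  isSmoothEmbedding₂ : Manifold.IsSmoothEmbedding (𝓡∂ n) (𝓡∂ n) ∞ h₂
  /-- `h₂` has open range. -/
  isOpen_range₂ : IsOpen (range h₂)

namespace HalfDiscPair

variable (D : HalfDiscPair n X Y)

/-- `h₁` is an open embedding. [folklore] -/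
theorem isOpenEmbedding₁ : IsOpenEmbedding D.h₁ :=
  IsOpenEmbedding.mk D.isSmoothEmbedding₁.isEmbedding D.isOpen_range₁

/-- `h₂` is an open embedding. [folklore] -/
theorem isOpenEmbedding₂ : IsOpenEmbedding D.h₂ :=
  IsOpenEmbedding.mk D.isSmoothEmbedding₂.isEmbedding D.isOpen_range₂

/-- `h₁` as an open partial homeomorphism `EuclideanHalfSpace n ⇀ X` (source `univ`, target
`range h₁`). [folklore] -/
def H₁ : OpenPartialHomeomorph (EuclideanHalfSpace n) X := D.isOpenEmbedding₁.toOpenPartialHomeomorph D.h₁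

/-- `h₂` as an open partial homeomorphism `EuclideanHalfSpace n ⇀ Y`. [folklore] -/
def H₂ : OpenPartialHomeomorph (EuclideanHalfSpace n) Y := D.isOpenEmbedding₂.toOpenPartialHomeomorph D.h₂

/-- `H₁` is `h₁` as a function. [folklore] -/
@[simp] theorem H₁_apply (v : EuclideanHalfSpace n) : D.H₁ v = D.h₁ v := rfl

/-- `H₂` is `h₂` as a function. [folklore] -/
@[simp] theorem H₂_apply (v : EuclideanHalfSpace n) : D.H₂ v = D.h₂ v := rfl

/-- The source of `H₁` is everything. [folklore] -/
@[simp] theorem H₁_source : D.H₁.source = univ := rfl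

/-- The source of `H₂` is everything. [folklore] -/
@[simp] theorem H₂_source : D.H₂.source = univ := rfl

/-- The target of `H₁` is `range h₁`. [folklore] -/
@[simp] theorem H₁_target : D.H₁.target = range D.h₁ :=
  D.isOpenEmbedding₁.toOpenPartialHomeomorph_target D.h₁

/-- The target of `H₂` is `range h₂`. [folklore] -/
@[simp] theorem H₂_target : D.H₂.target = range D.h₂ :=
  D.isOpenEmbedding₂.toOpenPartialHomeomorph_target D.h₂

/-- `H₁.symm` is a left inverse of `h₁`. [folklore] -/
@[simp] theorem H₁_symm_apply_apply (v : EuclideanHalfSpace n) : D.H₁.symm (D.h₁ v) = v :=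
  D.isOpenEmbedding₁.toOpenPartialHomeomorph_left_inv

/-- `H₂.symm` is a left inverse of `h₂`. [folklore] -/
@[simp] theorem H₂_symm_apply_apply (v : EuclideanHalfSpace n) : D.H₂.symm (D.h₂ v) = v :=
  D.isOpenEmbedding₂.toOpenPartialHomeomorph_left_inv

/-- `H₁.symm` is a right inverse of `h₁` on `range h₁`. [folklore] -/
theorem apply_H₁_symm_apply {p : X} (hp : p ∈ range D.h₁) : D.h₁ (D.H₁.symm p) = p :=
  IsOpenEmbedding.toOpenPartialHomeomorph_right_inv D.h₁ D.isOpenEmbedding₁ hp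

/-- `H₂.symm` is a right inverse of `h₂` on `range h₂`. [folklore] -/
theorem apply_H₂_symm_apply {q : Y} (hq : q ∈ range D.h₂) : D.h₂ (D.H₂.symm q) = q :=
  IsOpenEmbedding.toOpenPartialHomeomorph_right_inv D.h₂ D.isOpenEmbedding₂ hq

/-- **The gluing map** `Φ = h₂ ∘ ψ ∘ h₁⁻¹ : X ⇀ Y` between the punctured open unit half-discs
`h₁ {0 < ‖v‖ < 1}` and `h₂ {0 < ‖v‖ < 1}` (Juhász 2023, Def. 1.47). [cite: Juhasz2023, Def. 1.47] -/
def Φ : OpenPartialHomeomorph X Y := D.H₁.symm ≫ₕ (halfDiscInversion ≫ₕ D.H₂)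

/-- `Φ p = h₂ (ψ (h₁⁻¹ p))`. [cite: Juhasz2023, Def. 1.47] -/
theorem Φ_apply (p : X) : D.Φ p = D.h₂ (halfDiscInversion (D.H₁.symm p)) := rfl

/-- `Φ.symm q = h₁ (ψ (h₂⁻¹ q))`. [cite: Juhasz2023, Def. 1.47] -/
theorem Φ_symm_apply (q : Y) : D.Φ.symm q = D.h₁ (halfDiscInversion.symm (D.H₂.symm q)) := rfl

/-- The source of `Φ`: points `h₁ v` with `0 < ‖v‖ < 1`. [cite: Juhasz2023, Def. 1.47] -/
theorem mem_Φ_source {p : X} :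
    p ∈ D.Φ.source ↔ p ∈ range D.h₁ ∧ D.H₁.symm p ∈ (halfDiscInversion (n := n)).source := by
  simp [Φ]

/-- The target of `Φ`: points `h₂ v` with `0 < ‖v‖ < 1`. [cite: Juhasz2023, Def. 1.47] -/
theorem mem_Φ_target {q : Y} :
    q ∈ D.Φ.target ↔ q ∈ range D.h₂ ∧ D.H₂.symm q ∈ (halfDiscInversion (n := n)).source := by
  simp only [Φ, trans_target, symm_target, H₁_source, preimage_univ, inter_univ, mem_inter_iff,
    H₂_target, mem_preimage]
  rfl

/-- `h₁ v ∈ Φ.source ↔ 0 < ‖v‖ < 1`. [cite: Juhasz2023, Def. 1.47] -/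
theorem apply_mem_Φ_source {v : EuclideanHalfSpace n} :
    D.h₁ v ∈ D.Φ.source ↔ 0 < ‖v.val‖ ∧ ‖v.val‖ < 1 := by
  rw [mem_Φ_source, H₁_symm_apply_apply, mem_halfDiscInversion_source]
  exact ⟨fun h => h.2, fun h => ⟨mem_range_self v, h⟩⟩

/-- `h₂ v ∈ Φ.target ↔ 0 < ‖v‖ < 1`. [cite: Juhasz2023, Def. 1.47] -/
theorem apply_mem_Φ_target {v : EuclideanHalfSpace n} :
    D.h₂ v ∈ D.Φ.target ↔ 0 < ‖v.val‖ ∧ ‖v.val‖ < 1 := by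
  rw [mem_Φ_target, H₂_symm_apply_apply, mem_halfDiscInversion_source]
  exact ⟨fun h => h.2, fun h => ⟨mem_range_self v, h⟩⟩

/-- `Φ (h₁ (t • v)) = h₂ ((1 - t) • v)` for a unit vector `v` and `0 < t < 1`: `Φ` realises
Juhász's identification. [cite: Juhasz2023, Def. 1.47] -/
theorem Φ_apply_dilate {v : EuclideanHalfSpace n} (hv : ‖v.val‖ = 1) {t : ℝ} (ht : t ∈ Ioo (0 : ℝ) 1) :
    D.Φ (D.h₁ (EuclideanHalfSpace.dilate t v)) = D.h₂ (EuclideanHalfSpace.dilate (1 - t) v) := by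
  rw [Φ_apply, H₁_symm_apply_apply, halfDiscInversion_dilate hv ht.1 ht.2.le]

/-- **Smoothness of the gluing map**, by descent along the open immersion `h₁`:
`Φ ∘ h₁ = h₂ ∘ ψ` is smooth on the punctured open unit half-disc, and `h₁` is an open immersion,
so `Φ` is smooth on its source (`Literature.Topology.FourManifolds.contMDiffAt_of_comp_isImmersionAt`; Kosinski,
*Differential Manifolds*, VI.1). [cite: Kosinski1993, Ch. VI §1, proof of Thm (1.1)] -/
theorem contMDiffOn_Φ [IsManifold (𝓡∂ n) ∞ Y] : ContMDiffOn (𝓡∂ n) (𝓡∂ n) ∞ D.Φ D.Φ.source := by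
  intro p hp
  obtain ⟨⟨v, rfl⟩, hv⟩ := D.mem_Φ_source.1 hp
  rw [H₁_symm_apply_apply] at hv
  have hg : ContMDiffAt (𝓡∂ n) (𝓡∂ n) ∞ (fun w => D.h₂ (halfDiscInversion w)) v :=
    (D.isSmoothEmbedding₂.contMDiff _).comp v (contMDiffAt_halfDiscInversion hv)
  exact (contMDiffAt_of_comp_isImmersionAt (D.isSmoothEmbedding₁.isImmersion.isImmersionAt v)
    D.isOpenEmbedding₁.isOpenMap hg fun w => by rw [Φ_apply, H₁_symm_apply_apply]).contMDiffWithinAt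

/-- Smoothness of the inverse gluing map `Φ.symm = h₁ ∘ ψ ∘ h₂⁻¹`, by descent along `h₂`.
[cite: Kosinski1993, Ch. VI §1, proof of Thm (1.1)] -/
theorem contMDiffOn_Φ_symm [IsManifold (𝓡∂ n) ∞ X] :
    ContMDiffOn (𝓡∂ n) (𝓡∂ n) ∞ D.Φ.symm D.Φ.target := by
  intro q hq
  obtain ⟨⟨v, rfl⟩, hv⟩ := D.mem_Φ_target.1 hq
  rw [H₂_symm_apply_apply] at hv
  have hv' : v ∈ (halfDiscInversion (n := n)).symm.source := hv
  have hg : ContMDiffAt (𝓡∂ n) (𝓡∂ n) ∞ (fun w => D.h₁ (halfDiscInversion.symm w)) v :=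
    (D.isSmoothEmbedding₁.contMDiff _).comp v (contMDiffAt_halfDiscInversion hv)
  exact (contMDiffAt_of_comp_isImmersionAt (D.isSmoothEmbedding₂.isImmersion.isImmersionAt v)
    D.isOpenEmbedding₂.isOpenMap hg fun w => by rw [Φ_symm_apply, H₂_symm_apply_apply]).contMDiffWithinAt

/-! #### The punctured pieces -/

variable [T2Space X] [T2Space Y]

/-- The first punctured piece `X ∖ {h₁ 0}`. [cite: Juhasz2023, Def. 1.47] -/
abbrev A : TopologicalSpace.Opens X := puncture D.h₁

/-- The second punctured piece `Y ∖ {h₂ 0}`. [cite: Juhasz2023, Def. 1.47] -/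
abbrev B : TopologicalSpace.Opens Y := puncture D.h₂

/-- A nonzero vector of the closed half space: the inward unit normal `e₀ = EuclideanSpace.single 0 1`
(first coordinate `1 ≥ 0`). Its images `h₁ e₀`, `h₂ e₀` witness that the punctured pieces are
nonempty. [folklore] -/
def unitVec : EuclideanHalfSpace n := ⟨EuclideanSpace.single (0 : Fin n) (1 : ℝ), by simp⟩

omit [TopologicalSpace X] [ChartedSpace (EuclideanHalfSpace n) X] [TopologicalSpace Y]
  [ChartedSpace (EuclideanHalfSpace n) Y] [T2Space X] [T2Space Y] in
/-- `unitVec ≠ 0`. [folklore] -/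
theorem unitVec_ne_zero : (unitVec : EuclideanHalfSpace n) ≠ 0 := by
  intro h
  have h' := congrArg (fun z : EuclideanHalfSpace n => z.val 0) h
  simp [unitVec] at h'
  exact one_ne_zero (h'.trans rfl)

omit [T2Space Y] in
/-- The first punctured piece is nonempty (it contains `h₁ e₀`). [folklore] -/
theorem nonempty_A : Nonempty D.A :=
  ⟨⟨D.h₁ unitVec, fun h => unitVec_ne_zero (D.isSmoothEmbedding₁.isEmbedding.injective h)⟩⟩

omit [T2Space X] in
/-- The second punctured piece is nonempty. [folklore] -/
theorem nonempty_B : Nonempty D.B :=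
  ⟨⟨D.h₂ unitVec, fun h => unitVec_ne_zero (D.isSmoothEmbedding₂.isEmbedding.injective h)⟩⟩

omit [T2Space Y] in
/-- The source of `Φ` misses the centre `h₁ 0`. [cite: Juhasz2023, Def. 1.47] -/
theorem Φ_source_subset : D.Φ.source ⊆ D.A := fun p hp => by
  obtain ⟨⟨v, rfl⟩, hv⟩ := D.mem_Φ_source.1 hp
  rw [H₁_symm_apply_apply, mem_halfDiscInversion_source] at hv
  intro h0
  have h0' : v = 0 := D.isSmoothEmbedding₁.isEmbedding.injective h0
  rw [h0', show (0 : EuclideanHalfSpace n).val = 0 from rfl, norm_zero] at hv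
  exact lt_irrefl _ hv.1

omit [T2Space X] in
/-- The target of `Φ` misses the centre `h₂ 0`. [cite: Juhasz2023, Def. 1.47] -/
theorem Φ_target_subset : D.Φ.target ⊆ D.B := fun q hq => by
  obtain ⟨⟨v, rfl⟩, hv⟩ := D.mem_Φ_target.1 hq
  rw [H₂_symm_apply_apply, mem_halfDiscInversion_source] at hv
  intro h0
  have h0' : v = 0 := D.isSmoothEmbedding₂.isEmbedding.injective h0
  rw [h0', show (0 : EuclideanHalfSpace n).val = 0 from rfl, norm_zero] at hv
  exact lt_irrefl _ hv.1

/-- **The boundary connected sum relation is the graph of `Φ`.** For `a ∈ X ∖ {h₁ 0}`,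
`b ∈ Y ∖ {h₂ 0}`: `boundaryConnectedSumRel h₁ h₂ a b ↔ a ∈ Φ.source ∧ Φ a = b` (write
`h₁⁻¹ a = t • v` with `‖v‖ = 1`, `t = ‖h₁⁻¹ a‖`). [cite: Juhasz2023, Def. 1.47] -/
theorem boundaryConnectedSumRel_iff (a : D.A) (b : D.B) :
    boundaryConnectedSumRel D.h₁ D.h₂ a b ↔ (a : X) ∈ D.Φ.source ∧ D.Φ a = b := by
  constructor
  · rintro ⟨v, t, hv, ht, ha, hb⟩
    refine ⟨?_, ?_⟩
    · rw [ha, apply_mem_Φ_source, EuclideanHalfSpace.norm_val_dilate ht.1.le hv]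
      exact ht
    · rw [ha, hb, Φ_apply_dilate _ hv ht]
  · rintro ⟨hs, hΦ⟩
    obtain ⟨⟨w, hw⟩, hws⟩ := D.mem_Φ_source.1 hs
    rw [← hw, H₁_symm_apply_apply, mem_halfDiscInversion_source] at hws
    set t : ℝ := ‖w.val‖ with ht
    have ht0 : 0 < t := hws.1
    set v : EuclideanHalfSpace n := EuclideanHalfSpace.dilate t⁻¹ w with hv
    have hv1 : ‖v.val‖ = 1 := by
      rw [hv, EuclideanHalfSpace.val_dilate_of_nonneg (inv_nonneg.2 ht0.le), norm_smul,
        Real.norm_of_nonneg (inv_nonneg.2 ht0.le), ← ht, inv_mul_cancel₀ ht0.ne']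
    have hwv : w = EuclideanHalfSpace.dilate t v := by
      rw [hv, EuclideanHalfSpace.dilate_dilate ht0.le (inv_nonneg.2 ht0.le),
        mul_inv_cancel₀ ht0.ne', EuclideanHalfSpace.dilate_one]
    refine ⟨v, t, hv1, ⟨ht0, hws.2⟩, by rw [← hw, hwv], ?_⟩
    rw [← hΦ, ← hw, hwv, Φ_apply_dilate _ hv1 ⟨ht0, hws.2⟩]

omit [TopologicalSpace X] [ChartedSpace (EuclideanHalfSpace n) X] [TopologicalSpace Y]
  [ChartedSpace (EuclideanHalfSpace n) Y] [T2Space X] [T2Space Y] in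
/-- The unit half-sphere `{v ∈ ℝⁿ₊ | ‖v‖ = 1}` of the closed half space is compact. [folklore] -/
theorem isCompact_unitHalfSphere : IsCompact {v : EuclideanHalfSpace n | ‖v.val‖ = 1} := by
  have hcl : IsClosed {y : 𝔼 n | 0 ≤ y 0} := range_modelHalfSpace (n := n) ▸ (𝓡∂ n).isClosed_range
  have hce : IsClosedEmbedding (Subtype.val : EuclideanHalfSpace n → 𝔼 n) :=
    hcl.isClosedEmbedding_subtypeVal
  have hset : {v : EuclideanHalfSpace n | ‖v.val‖ = 1} =
      (Subtype.val : EuclideanHalfSpace n → 𝔼 n) ⁻¹' Metric.sphere (0 : 𝔼 n) 1 := by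
    ext v
    exact mem_sphere_zero_iff_norm.symm
  rw [hset]
  exact hce.isCompact_preimage (isCompact_sphere 0 1)

/-- **The graph of the boundary connected sum relation is closed** in
`(X ∖ {h₁ 0}) × (Y ∖ {h₂ 0})`: it is the trace of the compact set
`{(h₁ (t • v), h₂ ((1 - t) • v)) | ‖v‖ = 1, 0 ≤ t ≤ 1} ⊆ X × Y`, whose extra points `t = 0`,
`t = 1` have a removed centre as a coordinate (as for connected sums,
`Literature.Topology.FourManifolds.ConnectedSumData.isClosed_connectedSumRel`; Kosinski VI.1, proof of (1.1)). This makes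
`X ♮ Y` Hausdorff. [cite: Kosinski1993, Ch. VI §1, (1.1)] -/
theorem isClosed_boundaryConnectedSumRel :
    IsClosed {p : D.A × D.B | boundaryConnectedSumRel D.h₁ D.h₂ p.1 p.2} := by
  set g : EuclideanHalfSpace n × ℝ → X × Y := fun q =>
    (D.h₁ (EuclideanHalfSpace.dilate q.2 q.1), D.h₂ (EuclideanHalfSpace.dilate (1 - q.2) q.1))
    with hg
  have hdil : Continuous fun q : EuclideanHalfSpace n × ℝ => EuclideanHalfSpace.dilate q.2 q.1 := by
    apply Continuous.subtype_mk
    exact (continuous_snd.max continuous_const).smul (continuous_subtype_val.comp continuous_fst)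
  have hdil' : Continuous fun q : EuclideanHalfSpace n × ℝ =>
      EuclideanHalfSpace.dilate (1 - q.2) q.1 := by
    apply Continuous.subtype_mk
    exact ((continuous_const.sub continuous_snd).max continuous_const).smul
      (continuous_subtype_val.comp continuous_fst)
  have hgc : Continuous g :=
    (D.isOpenEmbedding₁.continuous.comp hdil).prodMk (D.isOpenEmbedding₂.continuous.comp hdil')
  set K := g '' ({v : EuclideanHalfSpace n | ‖v.val‖ = 1} ×ˢ Icc (0 : ℝ) 1) with hK
  have hKc : IsCompact K := (isCompact_unitHalfSphere.prod isCompact_Icc).image hgc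
  have heq : {p : D.A × D.B | boundaryConnectedSumRel D.h₁ D.h₂ p.1 p.2} =
      (fun p : D.A × D.B => ((p.1 : X), (p.2 : Y))) ⁻¹' K := by
    ext ⟨a, b⟩
    simp only [mem_setOf_eq, mem_preimage, hK, mem_image, mem_prod, mem_Icc, hg, Prod.mk.injEq,
      Prod.exists]
    constructor
    · rintro ⟨v, t, hv, ht, ha, hb⟩
      exact ⟨v, t, ⟨hv, ht.1.le, ht.2.le⟩, ha.symm, hb.symm⟩
    · rintro ⟨v, t, ⟨hv, h0, h1⟩, ha, hb⟩
      have ht0 : t ≠ 0 := by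
        rintro rfl
        exact a.2 (by rw [← ha, EuclideanHalfSpace.dilate_zero]; rfl)
      have ht1 : t ≠ 1 := by
        rintro rfl
        exact b.2 (by rw [← hb, sub_self, EuclideanHalfSpace.dilate_zero]; rfl)
      exact ⟨v, t, hv, ⟨lt_of_le_of_ne h0 (Ne.symm ht0), lt_of_le_of_ne h1 ht1⟩, ha.symm, hb.symm⟩
  rw [heq]
  exact hKc.isClosed.preimage (by fun_prop)

/-! #### The gluing map on the punctured pieces -/

/-- The gluing map of the boundary connected sum: `Φ` as an open partial homeomorphism between
the punctured pieces. [cite: Juhasz2023, Def. 1.47] -/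
def φ : OpenPartialHomeomorph D.A D.B :=
  D.Φ.subtypeRestr D.nonempty_A ≫ₕ (D.B.openPartialHomeomorphSubtypeCoe D.nonempty_B).symm

/-- The source of `φ` is that of `Φ`. [folklore] -/
theorem mem_φ_source {a : D.A} : a ∈ D.φ.source ↔ (a : X) ∈ D.Φ.source := by
  simp only [φ, trans_source, subtypeRestr_source, mem_preimage, symm_source,
    TopologicalSpace.Opens.openPartialHomeomorphSubtypeCoe_target, mem_inter_iff, subtypeRestr_coe,
    restrict_apply, SetLike.mem_coe, and_iff_left_iff_imp]
  exact fun h => D.Φ_target_subset (D.Φ.map_source h)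

/-- `φ` is `Φ` on the punctured piece. [folklore] -/
theorem coe_φ {a : D.A} (ha : a ∈ D.φ.source) : ((D.φ a : D.B) : Y) = D.Φ a := by
  have h : D.Φ a ∈ (D.B.openPartialHomeomorphSubtypeCoe D.nonempty_B).target := by
    rw [TopologicalSpace.Opens.openPartialHomeomorphSubtypeCoe_target]
    exact D.Φ_target_subset (D.Φ.map_source (D.mem_φ_source.1 ha))
  exact (D.B.openPartialHomeomorphSubtypeCoe D.nonempty_B).right_inv h

/-- The target of `φ` is that of `Φ`. [folklore] -/
theorem mem_φ_target {b : D.B} : b ∈ D.φ.target ↔ (b : Y) ∈ D.Φ.target := by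
  simp only [φ, trans_target, symm_target,
    TopologicalSpace.Opens.openPartialHomeomorphSubtypeCoe_source, symm_symm,
    TopologicalSpace.Opens.openPartialHomeomorphSubtypeCoe_coe, univ_inter, mem_preimage,
    subtypeRestr_def, TopologicalSpace.Opens.openPartialHomeomorphSubtypeCoe_target, mem_inter_iff,
    SetLike.mem_coe, and_iff_left_iff_imp]
  exact fun h => D.Φ_source_subset (D.Φ.map_target h)

/-- `φ.symm` is `Φ.symm` on the punctured piece. [folklore] -/
theorem coe_φ_symm {b : D.B} (hb : b ∈ D.φ.target) : ((D.φ.symm b : D.A) : X) = D.Φ.symm b := by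
  have hb' : (b : Y) ∈ (D.Φ.subtypeRestr D.nonempty_A).target := by
    have := hb
    simp only [φ, trans_target, mem_inter_iff, mem_preimage] at this
    exact this.2
  exact D.Φ.subtypeRestr_symm_apply D.nonempty_A hb'

/-- The boundary connected sum relation is the gluing relation of `φ`. [cite: Juhasz2023, Def. 1.47] -/
theorem boundaryConnectedSumRel_iff_φ (a : D.A) (b : D.B) :
    boundaryConnectedSumRel D.h₁ D.h₂ a b ↔ a ∈ D.φ.source ∧ D.φ a = b := by
  rw [D.boundaryConnectedSumRel_iff, D.mem_φ_source]
  refine and_congr_right fun ha => ?_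
  rw [Subtype.ext_iff, D.coe_φ (D.mem_φ_source.2 ha)]

/-- The graph of the gluing map is closed. [cite: Kosinski1993, Ch. VI §1, (1.1)] -/
theorem isClosed_graph_φ : IsClosed {p : D.A × D.B | p.1 ∈ D.φ.source ∧ D.φ p.1 = p.2} := by
  convert D.isClosed_boundaryConnectedSumRel using 2
  ext p
  exact (D.boundaryConnectedSumRel_iff_φ p.1 p.2).symm

/-- The gluing map is smooth. [cite: Kosinski1993, Ch. VI §1, proof of Thm (1.1)] -/
theorem contMDiffOn_φ [IsManifold (𝓡∂ n) ∞ Y] : ContMDiffOn (𝓡∂ n) (𝓡∂ n) ∞ D.φ D.φ.source := by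
  intro a ha
  rw [← ContMDiffWithinAt.subtypeVal_comp_iff]
  have h : ContMDiffOn (𝓡∂ n) (𝓡∂ n) ∞ (D.Φ ∘ (Subtype.val : D.A → X)) D.φ.source :=
    D.contMDiffOn_Φ.comp contMDiff_subtype_val.contMDiffOn fun a ha => D.mem_φ_source.1 ha
  exact (h a ha).congr (fun a' ha' => D.coe_φ ha') (D.coe_φ ha)

/-- The inverse gluing map is smooth. [cite: Kosinski1993, Ch. VI §1, proof of Thm (1.1)] -/
theorem contMDiffOn_φ_symm [IsManifold (𝓡∂ n) ∞ X] :
    ContMDiffOn (𝓡∂ n) (𝓡∂ n) ∞ D.φ.symm D.φ.target := by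
  intro b hb
  rw [← ContMDiffWithinAt.subtypeVal_comp_iff]
  have h : ContMDiffOn (𝓡∂ n) (𝓡∂ n) ∞ (D.Φ.symm ∘ (Subtype.val : D.B → Y)) D.φ.target :=
    D.contMDiffOn_Φ_symm.comp contMDiff_subtype_val.contMDiffOn fun b hb => D.mem_φ_target.1 hb
  exact (h b hb).congr (fun b' hb' => D.coe_φ_symm hb') (D.coe_φ_symm hb)

end HalfDiscPair

end Data

/-! ### §3 The glued manifold with boundary and the discharge -/

section Glue

variable {n : ℕ} [NeZero n] {X Y : Type u} [TopologicalSpace X] [T2Space X]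
  [ChartedSpace (EuclideanHalfSpace n) X] [IsManifold (𝓡∂ n) ∞ X]
  [TopologicalSpace Y] [T2Space Y] [ChartedSpace (EuclideanHalfSpace n) Y]
  [IsManifold (𝓡∂ n) ∞ Y]

namespace HalfDiscPair

variable (D : HalfDiscPair n X Y)

/-- The smooth gluing datum of the boundary connected sum: the punctured pieces `X ∖ {h₁ 0}`,
`Y ∖ {h₂ 0}` (model `𝓡∂ n`) glued along `φ` (Kosinski, *Differential Manifolds*, VI.1). Only the
topological part of `Literature.Topology.FourManifolds.SmoothGlueData.Glued` is used (its own atlas is for boundaryless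
models); the atlas comes from `Literature.Topology.FourManifolds.IsOpenCover₂`. [cite: Kosinski1993, Ch. VI §1, Thm (1.1)] -/
def glueData : SmoothGlueData (𝓡∂ n) (𝓡∂ n) D.A D.B (𝔼 n) :=
  ⟨D.φ, D.contMDiffOn_φ, D.contMDiffOn_φ_symm, ContinuousLinearEquiv.refl ℝ _,
    ContinuousLinearEquiv.refl ℝ _⟩

/-- The gluing map of the datum is `φ` (definitional). [folklore] -/
@[simp] theorem glueData_glue : D.glueData.glue = D.φ := rfl

/-- The two projections of the punctured pieces to the glued space form an open cover by two open
embeddings. [folklore] -/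
theorem isOpenCover₂ : IsOpenCover₂ D.glueData.inl D.glueData.inr :=
  ⟨D.glueData.isOpenEmbedding_inl, D.glueData.isOpenEmbedding_inr,
    D.glueData.range_inl_union_range_inr⟩

/-- **The atlas of `X ♮ Y`** (model `EuclideanHalfSpace n`): the two-chart gluing of the atlases
of the punctured pieces (`Literature.Topology.FourManifolds.IsOpenCover₂.chartedSpace`, no change of model). A `def`, installed
as an instance inside proofs. [cite: Kosinski1993, Ch. VI §1, Thm (1.1)] -/
@[reducible] def chartedSpaceGlued : ChartedSpace (EuclideanHalfSpace n) D.glueData.Glued :=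
  D.isOpenCover₂.chartedSpace (Homeomorph.refl _)

/-- **`X ♮ Y` is a smooth manifold with boundary**: the transition map of the cover is the smooth
gluing map `φ` (`Literature.Topology.FourManifolds.IsOpenCover₂.isManifold`). [cite: Kosinski1993, Ch. VI §1, Thm (1.1)] -/
theorem isManifold_glued :
    @IsManifold ℝ _ (𝔼 n) _ _ (EuclideanHalfSpace n) _ (𝓡∂ n) ∞ D.glueData.Glued _
      D.chartedSpaceGlued := by
  refine D.isOpenCover₂.isManifold (Homeomorph.refl _) contMDiff_id contMDiff_id ?_
  intro _ _
  set c := D.isOpenCover₂ with hc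
  constructor
  · have hs : (c.inl ≫ₕ c.inr.symm).source = D.φ.source := by
      ext a
      rw [trans_source, c.inl_source, univ_inter, mem_preimage, symm_source, c.inr_target,
        c.inl_apply]
      exact D.glueData.inl_mem_range_inr_iff
    rw [hs]
    refine D.contMDiffOn_φ.congr fun a ha => ?_
    rw [coe_trans, comp_apply, c.inl_apply, ← glueData_glue,
      ← D.glueData.inr_glue ha]
    exact c.inr_symm_apply_apply _
  · have ht : (c.inl ≫ₕ c.inr.symm).target = D.φ.target := by
      ext b
      rw [trans_target, symm_target, c.inr_source, univ_inter, mem_preimage, symm_symm,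
        c.inr_apply, c.inl_target]
      exact D.glueData.inr_mem_range_inl_iff
    rw [ht]
    refine D.contMDiffOn_φ_symm.congr fun b hb => ?_
    rw [coe_trans_symm, comp_apply, symm_symm, c.inr_apply, ← glueData_glue,
      ← D.glueData.inl_glue_symm hb]
    exact c.inl_symm_apply_apply _

/-- `X ♮ Y` is second countable: it is covered by the two open embedded second countable
punctured pieces. [folklore] -/
theorem secondCountableTopology_glued [SecondCountableTopology X] [SecondCountableTopology Y] :
    SecondCountableTopology D.glueData.Glued := by
  set d := D.glueData with hd
  have e₁ : D.A ≃ₜ range d.inl := d.isOpenEmbedding_inl.toIsEmbedding.toHomeomorph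
  have e₂ : D.B ≃ₜ range d.inr := d.isOpenEmbedding_inr.toIsEmbedding.toHomeomorph
  haveI : SecondCountableTopology (range d.inl) := e₁.symm.secondCountableTopology
  haveI : SecondCountableTopology (range d.inr) := e₂.symm.secondCountableTopology
  let U : Bool → Set d.Glued := fun b => cond b (range d.inl) (range d.inr)
  haveI : ∀ b, SecondCountableTopology (U b) := fun b => by
    cases b
    · exact (inferInstance : SecondCountableTopology (range d.inr))
    · exact (inferInstance : SecondCountableTopology (range d.inl))
  refine TopologicalSpace.secondCountableTopology_of_countable_cover (U := U) (fun b => ?_) ?_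
  · cases b
    · exact d.isOpen_range_inr
    · exact d.isOpen_range_inl
  · rw [eq_univ_iff_forall]
    intro p
    rcases d.exists_inl_or_inr p with ⟨a, rfl⟩ | ⟨b, rfl⟩
    · exact mem_iUnion.2 ⟨true, mem_range_self a⟩
    · exact mem_iUnion.2 ⟨false, mem_range_self b⟩

/-- **The boundary connected sum exists.** The glued space of the punctured pieces
`X ∖ {h₁ 0}`, `Y ∖ {h₂ 0}` along `φ` is a smooth `n`-manifold with boundary (Hausdorff, second
countable) which is an open gluing of the pieces along `boundaryConnectedSumRel h₁ h₂` — Juhász's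
`X ♮ Y` (Def. 1.47) in the relational form of `Literature.Topology.FourManifolds.IsBoundaryConnectedSum`. Hausdorff because
the graph of the relation is closed (Kosinski VI.1, proof of (1.1)).
[cite: Juhasz2023, Def. 1.47] [cite: Kosinski1993, Ch. VI §1, Thm (1.1)] -/
theorem exists_isOpenGluing [SecondCountableTopology X] [SecondCountableTopology Y] :
    ∃ (P : Type u) (_ : TopologicalSpace P) (_ : T2Space P) (_ : SecondCountableTopology P)
      (_ : ChartedSpace (EuclideanHalfSpace n) P) (_ : IsManifold (𝓡∂ n) ∞ P),
      IsOpenGluing (𝓡∂ n) (𝓡∂ n) (𝓡∂ n) (A := puncture D.h₁) (B := puncture D.h₂) (P := P)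
        (boundaryConnectedSumRel D.h₁ D.h₂) := by
  letI : ChartedSpace (EuclideanHalfSpace n) D.glueData.Glued := D.chartedSpaceGlued
  haveI hM : IsManifold (𝓡∂ n) ∞ D.glueData.Glued := D.isManifold_glued
  haveI : T2Space D.glueData.Glued := D.glueData.t2Space_of_isClosed_graph D.isClosed_graph_φ
  haveI : SecondCountableTopology D.glueData.Glued := D.secondCountableTopology_glued
  have hl : Manifold.IsSmoothEmbedding (𝓡∂ n) (𝓡∂ n) ∞ D.glueData.inl :=
    D.isOpenCover₂.isSmoothEmbedding_left (Homeomorph.refl _) hM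
      (ContinuousLinearEquiv.refl ℝ (𝔼 n)) fun _ => rfl
  have hr : Manifold.IsSmoothEmbedding (𝓡∂ n) (𝓡∂ n) ∞ D.glueData.inr :=
    D.isOpenCover₂.isSmoothEmbedding_right (Homeomorph.refl _) hM
      (ContinuousLinearEquiv.refl ℝ (𝔼 n)) fun _ => rfl
  exact ⟨D.glueData.Glued, inferInstance, inferInstance, inferInstance, inferInstance,
    inferInstance, D.glueData.inl, D.glueData.inr, hl, D.glueData.isOpen_range_inl, hr,
    D.glueData.isOpen_range_inr, D.glueData.range_inl_union_range_inr,
    fun a b => D.glueData.inl_eq_inr_iff.trans (D.boundaryConnectedSumRel_iff_φ a b).symm⟩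

end HalfDiscPair

end Glue

/-- **Existence of boundary connected sums**: discharge of the named fact
`Literature.Topology.FourManifolds.exists_isOpenGluing_boundaryConnectedSumRel` (`BoundaryConnectedSum.lean`). For half-discs
`h₁`, `h₂` with open ranges in smooth `n`-manifolds with boundary `X`, `Y` (Hausdorff, second
countable), the pushout of `X ∖ {h₁ 0}` and `Y ∖ {h₂ 0}` along `h₁ (t • v) ∼ h₂ ((1 - t) • v)` is
a smooth `n`-manifold with boundary (Hausdorff, second countable) which is the open gluing of the
punctured pieces along `boundaryConnectedSumRel h₁ h₂` — Juhász's `X ♮ Y`, *Differential and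
Low-Dimensional Topology* (2023), Def. 1.47; smooth structure on an identification space as in
Kosinski, *Differential Manifolds* (1993), VI.1, and Hirsch, *Differential Topology* (1976),
Ch. 8 §2. [cite: Juhasz2023, Def. 1.47] -/
theorem exists_isOpenGluing_boundaryConnectedSumRel_holds :
    exists_isOpenGluing_boundaryConnectedSumRel.{u} := by
  intro n _ X Y _ _ _ _ _ _ _ _ _ _ h₁ h₂ e₁ o₁ e₂ o₂
  exact (HalfDiscPair.mk h₁ h₂ e₁ o₁ e₂ o₂).exists_isOpenGluing

end Literature.Topology.FourManifolds

end
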